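import Literature.Analysis.FluidPDE.Tao2016AveragedNS.SplitDelayCircuitShadowing
import HarnessLib

/-!
# Tao 2016, Theorem 5.3: the clock mode of THE trajectory is non-negative throughout the epoch,
# and Theorem 5.3 for the doubled circuit along pseudo-orbits with no hypothesis on the asymmetry

T. Tao, *Finite time blowup for an averaged three-dimensional Navier–Stokes equation*, J. Amer.
Math. Soc. **29** (2016) 601–674 = arXiv:1402.0290v3, proof of Theorem 5.3, p. 29:
"`b(t) = εt + O(K⁻²⁰ε)` for `t ∈ [0,t_c]`" and "`b(t) ≳ ε` for `t ∈ [t_c, 2]`" [`Tao2016AveragedNS`];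
shadowing as in [`HairerNorsettWanner1993`, Thm I.10.2].

HONEST FRAMING (cell harvest/h2-tao-ladder, rung 1 of a ladder of MODEL equations): two small
closures of the one-epoch story of `SplitDelayCircuitShadowing.lean` / `SplitDelayCircuitChannels.lean`.
(1) `delaySolution_clock_nonneg` packages the tree's internal estimates `Thm53.b_linear`
(`|b - εt| ≤ 17εt/K²⁰` up to the critical time) and `Thm53.b_lower_after` (`b ≥ ε/8` from the
critical time to `2`) into the statement the channel theorems take as hypothesis: along THE
trajectory of (5.5)/(5.6), the clock `b ≥ 0` on `[0,2]` (for `K ≥ 16`, `0 < ε ≤ e^{-10K¹⁰}/K¹⁰⁰`).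
(2) `splitPseudoOrbit_delayedAbruptTransition_of_init` composes the tree's
`splitPseudoOrbit_delayedAbruptTransition` with `IsPseudoOrbit.asymPart_le_gronwallBound`: Theorem 5.3
for the doubled circuit along a `δ`-pseudo-orbit, with the asymmetry bound SUPPLIED (generic linear
Grönwall envelope of the initial asymmetry, `n₀`-free) rather than assumed. Finite-dimensional ODE
facts; nothing here is the §6 induction and nothing concerns Navier–Stokes.
-/

noncomputable section

open Set Metric Real
open scoped NNReal

namespace Literature.Analysis.FluidPDE.Tao2016AveragedNS

/-- **The clock of THE trajectory is non-negative on the whole epoch `[0,2]`** (proof of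
Theorem 5.3, p. 29: `b = εt + O(K⁻²⁰εt)` up to the critical time `t_c`, then `b ≥ ε/8` on
`[t_c, 2]`): for `K ≥ 16` and `0 < ε ≤ e^{-10K¹⁰}/K¹⁰⁰`, `delaySolution K ε t 1 ≥ 0` for all
`t ∈ [0,2]`. [cite: Tao2016AveragedNS, Theorem 5.3 proof p. 29] -/
theorem delaySolution_clock_nonneg {K ε : ℝ} (hK : 16 ≤ K) (hε : 0 < ε)
    (hεle : ε ≤ exp (-(10 * K ^ 10)) / K ^ 100) {t : ℝ} (ht : t ∈ Icc (0 : ℝ) 2) :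
    0 ≤ delaySolution K ε t 1 := by
  have hK0 : 0 < K := by linarith
  have hK1 : 1 ≤ K := by linarith
  obtain ⟨hε1, hεK, -, hεexp⟩ := Thm53.eps_facts hK hε hεle
  have hX := hasDerivAt_delaySolution K ε
  have h0 := delaySolution_zero K ε
  obtain ⟨τ, hτ0, hτ2, hcτ, hτeq⟩ := Thm53.exists_hitTime (Thm53.continuous_traj hX 2)
    (θ := ε ^ 2 / K ^ 10) (T := 2) two_pos (by rw [Thm53.init_c h0]; positivity)
  obtain ⟨-, -, hτ1, -, -⟩ := Thm53.tc_window hX h0 hε hε1 hK hεK hτ0 hτ2 hcτ hτeq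
  by_cases htτ : t ≤ τ
  · -- before the critical time: `b ≥ εt(1 - 17/K²⁰) ≥ 0`
    have hlin := Thm53.b_linear hX h0 hε hε1 hK1 hτ2 hεK hcτ (t := t) ⟨ht.1, htτ⟩
    have h17 : 17 * ε / K ^ 20 * t ≤ ε * t := by
      have hK20 : (17 : ℝ) ≤ K ^ 20 := by
        have : (16 : ℝ) ^ 20 ≤ K ^ 20 := pow_le_pow_left₀ (by norm_num) hK 20
        linarith
      have h1 : 17 * ε / K ^ 20 ≤ ε := by
        rw [div_le_iff₀ (by positivity)]
        nlinarith
      exact mul_le_mul_of_nonneg_right h1 ht.1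
    have := (abs_sub_le_iff.1 hlin).2
    linarith
  · -- after the critical time: `b ≥ ε/8`
    push Not at htτ
    have h := Thm53.b_lower_after hX h0 hε hε1 hK hεK hεexp hτ1 hτ2 hcτ (t := t) ⟨htτ.le, ht.2⟩
    linarith

/-- **Theorem 5.3 for the doubled circuit along pseudo-orbits, asymmetry bound supplied (PROVED).**
With the constants `C, K₀, ε₁(K)` of the tree's Theorem 5.3: for `K ≥ K₀`, `0 < ε ≤ ε₁(K)`, every
`δ`-pseudo-orbit `X` of the split circuit on `[0,T]` in the sup-ball `R` (`R′ ≥ max(1, √2R)`) whose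
symmetric part starts `δ₀`-close to (5.6) makes the delayed abrupt transition in
`(S_a, b, S_c, S_d, S_ã)` up to
`C K⁻¹⁰ + gronwallBound δ₀ (delayLipschitz K ε R′) (√2δ + C_Q η²) t` with the EXPLICIT, `n₀`-free
asymmetry envelope `η = gronwallBound ‖asymPart (X 0)‖ (C_L√2R) (√2δ) T` (no hypothesis on the
asymmetry along the window). [cite: Tao2016AveragedNS, Theorem 5.3] -/
theorem splitPseudoOrbit_delayedAbruptTransition_of_init :
    ∃ C : ℝ, 0 < C ∧ ∃ K₀ : ℝ, 0 < K₀ ∧ ∀ K : ℝ, K₀ ≤ K → ∃ ε₁ : ℝ, 0 < ε₁ ∧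
      ∀ ε : ℝ, 0 < ε → ε ≤ ε₁ → ∀ (R R' : ℝ≥0), 1 ≤ R' → Real.sqrt 2 * (R : ℝ) ≤ R' →
        ∀ (δ δ₀ T : ℝ) (X : ℝ → Fin 9 → ℝ),
        IsPseudoOrbit (splitDelayCircuit K ε) δ R T X → ‖symPart (X 0) - delayInit‖ ≤ δ₀ →
        ∃ tc : ℝ, |tc - Real.sqrt 2| ≤ C / Real.sqrt K ∧
          (∀ t ∈ Icc 0 T, t ≤ tc - 1 / Real.sqrt K →
            |symPart (X t) 0 - 1| ≤ C / K ^ 10 + gronwallBound δ₀ (delayLipschitz K ε R')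
                (Real.sqrt 2 * δ + splitCorrectionConst K ε *
                  gronwallBound ‖asymPart (X 0)‖ (asymFieldConst K ε * (Real.sqrt 2 * R))
                    (Real.sqrt 2 * δ) T ^ 2) t ∧
            ∀ i : Fin 5, i ≠ 0 →
              |symPart (X t) i| ≤ C / K ^ 10 + gronwallBound δ₀ (delayLipschitz K ε R')
                (Real.sqrt 2 * δ + splitCorrectionConst K ε *
                  gronwallBound ‖asymPart (X 0)‖ (asymFieldConst K ε * (Real.sqrt 2 * R))
                    (Real.sqrt 2 * δ) T ^ 2) t) ∧
          (∀ t ∈ Icc 0 T, tc + 1 / Real.sqrt K ≤ t →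
            |symPart (X t) 4 - 1| ≤ C / K ^ 10 + gronwallBound δ₀ (delayLipschitz K ε R')
                (Real.sqrt 2 * δ + splitCorrectionConst K ε *
                  gronwallBound ‖asymPart (X 0)‖ (asymFieldConst K ε * (Real.sqrt 2 * R))
                    (Real.sqrt 2 * δ) T ^ 2) t ∧
            ∀ i : Fin 5, i ≠ 4 →
              |symPart (X t) i| ≤ C / K ^ 10 + gronwallBound δ₀ (delayLipschitz K ε R')
                (Real.sqrt 2 * δ + splitCorrectionConst K ε *
                  gronwallBound ‖asymPart (X 0)‖ (asymFieldConst K ε * (Real.sqrt 2 * R))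
                    (Real.sqrt 2 * δ) T ^ 2) t) := by
  obtain ⟨C, hC, K₀, hK₀, h⟩ := splitPseudoOrbit_delayedAbruptTransition
  refine ⟨C, hC, K₀, hK₀, fun K hK => ?_⟩
  obtain ⟨ε₁, hε₁, hε⟩ := h K hK
  refine ⟨ε₁, hε₁, fun ε hε0 hεle R R' hR' hRR' δ δ₀ T X hX h0 => ?_⟩
  have hKnn : 0 ≤ K := hK₀.le.trans hK
  refine hε ε hε0 hεle R R' hR' hRR' δ δ₀ _ T X hX h0 fun t ht => ?_
  -- the generic Grönwall envelope is monotone in time (δ ≥ 0 along a pseudo-orbit)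
  have hδ0 : 0 ≤ δ := by
    obtain ⟨V, -, hVδ⟩ := hX.defect t ht
    exact (norm_nonneg _).trans hVδ
  refine (hX.asymPart_le_gronwallBound hKnn hε0 ⟨ht.1, ht.2.le⟩).trans ?_
  exact gronwallBound_mono (norm_nonneg _) (by positivity)
    (by unfold asymFieldConst; positivity) ht.2.le

end Literature.Analysis.FluidPDE.Tao2016AveragedNS
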